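import Summits.CriticalPhenomena.PercolationContinuityZ3.Theorems.Transplant.GrigorchukLamplighterCylinderNontrivial
import Summits.CriticalPhenomena.PercolationContinuityZ3.Theorems.Transplant.GrigorchukSuperpolynomialGrowth
import HarnessLib

/-!
# Bartholdi–Erschler's graph `Cay(ℤ ≀_X 𝔊; a, b, c, d, s)` is NOT of polynomial growth (the lower half of "intermediate growth") — kernel

builds on p205010 (kernel theorem, internal audit signed; external expert review pending) — nothing in this file uses p205010.  Lane `prim-bschramm`, seat
`prim-bschramm-p3` gen 38 (DESIGN OWNER; offer O18 — a words input for the lead's V164: 'intermediate growth, BOTH halves kernel').  Helper file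
(`--supports stmt-CriticalPhenomena-4575 --as helper`).  One def (`fibreHom`), no instance.  Nothing about `θ(p_c)` here; no growth EXPONENT is typed
or claimed.

THE POINT.  «GrigorchukLamplighterSubexponentialGrowth» (p624625) `cay_not_hasExponentialGrowth` is the UPPER half (no exponential rate).  The LOWER half — no bound
`|B(x, n)| ≤ C·(n+1)^D` — is inherited from the first Grigorchuk group: the fibre map `g ↦ (0, g)` of «GrigorchukLamplighterCylinderNontrivial» (p634372,
`fibre_adj_iff`) is an injective graph homomorphism `Cay(𝔊; a,b,c,d) → Cay`, so balls of `Cay(𝔊; a,b,c,d)` inject into balls of `Cay` of the same radius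
(`ballVolume_le_of_hom_injective`), and «GrigorchukSuperpolynomialGrowth» (p618494) `not_polynomialGrowth_cayley` (Grigorchuk 1984, kernel) transfers:
**`cay_not_polynomialGrowth`**.  With p624625: the growth of B–E's graph is INTERMEDIATE — both halves kernel (the printed rate `exp(n^{α₀} log n)` is NOT typed).
[cite: BartholdiErschler2012, §2, Lemma 5.1 / Thm. 5.3 (growth of ℤ ≀_X 𝔊)] [cite: Grigorchuk1984, Thm. (intermediate growth: the lower bound)] [cite: LyonsPeres2016, §7.2]
-/

noncomputable section

namespace Summit.CriticalPhenomena.PercolationContinuityZ3.Theorems.Transplant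

namespace Grigorchuk

open SimpleGraph Literature.Probability.LatticeModels
open Literature.Barriers.CriticalPhenomena (graphBall graphBall_finite ballVolume)
open scoped Classical

/-- **Balls inject along an injective graph homomorphism**: `|B_G(x, n)| ≤ |B_{G'}(f x, n)|`. [cite: LyonsPeres2016, §7.2] -/
theorem ballVolume_le_of_hom_injective {V W : Type} {G : SimpleGraph V} {G' : SimpleGraph W} [G'.LocallyFinite] (f : G →g G')
    (hf : Function.Injective f) (x : V) (n : ℕ) : ballVolume G x n ≤ ballVolume G' (f x) n := by
  have hsub : f '' graphBall G x n ⊆ graphBall G' (f x) n := by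
    rintro _ ⟨w, ⟨p, hp⟩, rfl⟩
    exact ⟨p.map f, by rw [Walk.length_map]; exact hp⟩
  have h := Set.ncard_le_ncard hsub (graphBall_finite G' (f x) n)
  rw [Set.ncard_image_of_injective _ hf] at h
  exact h

/-- **The fibre homomorphism** `g ↦ (0, g)`: `Cay(𝔊; a, b, c, d) →g Cay(ℤ ≀_X 𝔊; a, b, c, d, s)` (the fibre map of «…CylinderNontrivial» through `r = 1`).
[cite: BartholdiErschler2012, §2 (the embedding g ↦ (1, g))] -/
def fibreHom : (mulCayley (↑({aG, bG, cG, dG} : Finset ↥grigorchukGroup) : Set ↥grigorchukGroup)) →g Cay where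
  toFun g := ⟨tree (g : Equiv.Perm Ray), tree_mem_wreathZ g.2⟩
  map_rel' {g g'} h := by
    have h' := (fibre_adj_iff 1 g g').2 h
    rwa [one_mul, one_mul] at h'

/-- The fibre homomorphism is injective. [folklore] -/
theorem fibreHom_injective : Function.Injective fibreHom := by
  intro g g' h
  have h1 : (⟨tree (g : Equiv.Perm Ray), tree_mem_wreathZ g.2⟩ : ↥wreathZ) = ⟨tree (g' : Equiv.Perm Ray), tree_mem_wreathZ g'.2⟩ := h
  have h2 := congrArg (fun w : ↥wreathZ => ((w : LampGroup ℤ)).right) h1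
  simp only [tree_right] at h2
  exact Subtype.ext h2

/-- **`Cay(ℤ ≀_X 𝔊; a, b, c, d, s)` IS NOT OF POLYNOMIAL GROWTH — kernel**: it admits no bound `|B(x, n)| ≤ C·(n+1)^D` (real `C`, `D`).  With
«GrigorchukLamplighterSubexponentialGrowth» `cay_not_hasExponentialGrowth`: INTERMEDIATE growth, both halves kernel; no exponent typed.
[cite: BartholdiErschler2012, Lemma 5.1 / Thm. 5.3] [cite: Grigorchuk1984, Thm. (intermediate growth: the lower bound)] -/
theorem cay_not_polynomialGrowth : ¬ ∃ C D : ℝ, ∀ (x : ↥wreathZ) (n : ℕ), (ballVolume Cay x n : ℝ) ≤ C * ((n : ℝ) + 1) ^ D := by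
  rintro ⟨C, D, hCD⟩
  haveI : Cay.LocallyFinite := by unfold Cay; infer_instance
  refine not_polynomialGrowth_cayley ⟨C, D, fun x n => ?_⟩
  have h := ballVolume_le_of_hom_injective fibreHom fibreHom_injective x n
  exact (Nat.cast_le.2 h).trans (hCD _ n)

end Grigorchuk

end Summit.CriticalPhenomena.PercolationContinuityZ3.Theorems.Transplant

end
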